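import Summits.QuantumFields.BalabanUV.Beta.FP.PerfectTelescopingHolds

/-!
# `BalabanUV.Beta.FP.PerfectColumnSemigroup` — road «FP» for binder row D1, sub-row **MS-1-BOT (i)** (owner d1-p3 gen 12, `LEAVES-FP.md` l.545;
# design `HOME/b2b-balaban-beta-d1-p3/JETS-JM-DESIGN.md` v2 §4, 14062fd38d231c27): **THE PERFECT COLUMNS COMPOSE** — the `(field, multiplier)` block of the
# `(m+1)`-fold perfect resolvent is the ONE-step perfect column composed with the `m`-fold perfect column read on the `Lc`-sublattice, EXACTLY, in the
# adopted units (`d + 1 = 4`, `Lc ≥ 2`, every `m ≥ 1`; UNCONDITIONAL — no hypothesis beyond `2 ≤ Lc`, `1 ≤ m`)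

HONEST DEPENDENCY (page 1, mandatory): continuum YM on T⁴ ⇐ BetaPertH ∧ nine spine estimates (0/9 proved); BetaPertH ⇐ (D1) ∧ (D4) ∧ CAP+tail;
G-an2-4 gates asym, D1 and NE2/3/4.  HONEST FRAMING (cell contract, verbatim): «discharging `BetaPertH` makes Bałaban's UV stability UNCONDITIONAL —
a real constructive-QFT result; it is NOT the continuum limit and NOT the Clay problem.»  THIS MODULE is [folklore] lattice bookkeeping + ONE Tannery
passage to the limit over the road's OWN perfect resolvents `KPerf Lc (sfStep Lc) (smStep 3 Lc) m` (`FP/PerfectObjectsT`); it composes BY NAME an5's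
two-level reproduction of minimisers `ResolventComposition.wH_reproduction` (every finite level), the block-contour decimation `OneStepKernelFamily.dec`
(`PerfectTelescopingFiniteComposite.KTot_inl_inr_zsmul`, `StepDriftWitness.sum_LegIdx_eq_contourSum`) and the G-an2-4 lineage's UNCONDITIONAL K-side theorems
`GAN24.RealRateKMHolds.tendsto_KTot_KPerf_holds` (entrywise convergence of the unit-rescaled (j, m)-resolvents) and `GAN24.KSlotJMHolds.kSlotJM_holds`
(`j`-uniform decay).  No `def`, no `def … : Prop`, nothing cited, 0 sorry; 0 estimates of Bałaban's constrained objects; 0∕4 row-D1 binders;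
NOT the BOTTOM pair telescoping of Γ (sub-row MS-1-BOT (ii)), NOT (STEP)∕SDF, NOT (ASYMP), NOT D1, NOT BetaPertH, NOT continuum, NOT Clay.
«not in print; our bookkeeping» (orientation only: [B9] p. 393 (3.15) «Q_j(U) = Q(Ū^{j−1})·…·Q(Ū)Q(U)» — the semigroup of averagings, whose U = 1 minimiser
shadow this is; nothing printed is used).
ABSOLUTE RULE (cell charter, verbatim): «No internally-minted statement may enter as a cited fact. Every hypothesis is either kernel-proved in this package or a
verbatim quotation of a PUBLISHED theorem with page reference. The manuscript(s) under audit are NOT citable for their own disputed steps — they are the thing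
under adjudication; programme-internal (2001/route/tribunal) claims are never citable.»

WHY (road FP's N2 ∕ (STEP) at the perfect objects, owner's located reading JETS-JM-DESIGN v2 §4 (a)(b)): the terminal END's `hSDF` is the BOTTOM one-loop Fubini split
(`StepDefectInherit.defect TP RP m`, `RP m` = `TP 1` transported through the m-fold columns `colOf (KPerf m)`), while the landed K-bricks
(`PerfectTelescopingHolds.kPerf_pair_telescoping_holds ∕ _sum`) are the TOP split; the bridge between the two, and the transport composition law
«transport_{m+1} = transport_1 ∘ transport_m» that N2a ∕ N5 use, is the COLUMN SEMIGROUP proved here.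

CONTENT.
* §1 (finite level, every `d`, `Lc ≥ 1`, `j`, `m`): `contourSum_Hcol_eq_KTot` (the `Lc^(j+1)`-contour sum of the translated level-`Lc^(j+1+m)` minimiser column IS
  `(Lc^(j+1))^(d+2)` · the `(inl, inr)` block of the `(j+1, m)`-resolvent); **`kTot_column_semigroup`**:
  `KTot (Lc^(j+1+m)) (Lc^j) x′ (Lc^(m+1)•z′) (inl κ) (inr μ) = (Lc^(j+1))^(d+2) · Σ'_{w′} Σ_{l″} KTot (Lc^(j+1)) (Lc^j) x′ (Lc•w′) (inl κ) (inr l″) ·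
  KTot (Lc^(j+1+m)) (Lc^(j+1)) w′ (Lc^m•z′) (inl l″) (inr μ)` — `wH_reproduction` at `(N′, M, L) = (Lc^(j+1+m), Lc^(j+1), Lc^m)` read through `dec (Lc^j)`.
* §2 (adopted units `sfStep Lc j = Lc^j`, `smStep d Lc j = Lc^{j(d+1)}`): `sfStep_mul_smStep_succ` (the unit factor of level `j+1` is `(Lc^(j+1))^(d+2)`),
  **`unitK_kTot_column_semigroup`** — the same identity for `U_{j,m} := unitK (sfStep Lc j) (smStep d Lc j) (KTot (Lc^(j+m)) (Lc^j))` with scalar EXACTLY `1`.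
* §3 (`d + 1 = 4`, `2 ≤ Lc`, `1 ≤ m`): `abs_le_of_decays`; **`kPerf_column_semigroup`**:
  `[KPerf … (m+1)] x′ (Lc^(m+1)•z′) (inl κ) (inr μ) = Σ'_{w′} Σ_{l″} [KPerf … 1] x′ (Lc•w′) (inl κ) (inr l″) · [KPerf … m] w′ (Lc^m•z′) (inl l″) (inr μ)` —
  §2 at every `j`, the three families converge entrywise (`tendsto_KTot_KPerf_holds`; the `(j+1, m)` family through the index shift `j ↦ j+1`), the
  `w′`-series is dominated uniformly in `j` (`kSlotJM_holds`: `j`-uniform `Decays` of the one-step family ⟹ summable majorant `summable_exp_dilate`; the m-fold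
  family `j`-uniformly bounded), Tannery (`tendsto_tsum_of_dominated_convergence`), uniqueness of limits.
Provenance: road «FP» OWNER, unit b2b-balaban-beta-d1-p3 gen 12 (prover-b2b-balaban-beta-d1-p3-g12-0), 2026-08-21; no existing file touched.
-/

noncomputable section

namespace Summit.QuantumFields.BalabanUV.Beta.FP.PerfectColumnSemigroup

open Finset Filter Topology
open scoped BigOperators
open Literature.MathematicalPhysics.QuantumFieldTheory.Balaban1983to89
open Literature.MathematicalPhysics.QuantumFieldTheory.Balaban1983to89.Beta
open B12Sec2to5 (l1 l1_nonneg)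
open AffineAveraging (Form1 contourSum)
open ExpKernelCalculus (MKer Decays)
open KernelSpecInstance (wH)
open OneStepResolventKernel (Fib)
open OneStepKernelFamily (legPt LegIdx KInvStep)
open KKTFluctuationEnergy (summable_mul_of_bdd summable_mul_of_bdd')
open ResolventComposition (Hcol Hcol_bdd_summable wH_reproduction summable_wH_sub_zsmul)
open StepDriftWitness (sum_LegIdx_eq_contourSum)
open Summit.QuantumFields.BalabanUV.Beta.HessKerDressedUnits (unitK)
open Summit.QuantumFields.BalabanUV.Beta.GAN24.CombesThomas (sfStep smStep)
open Summit.QuantumFields.BalabanUV.Beta.GAN24.RealRateKMHolds (tendsto_KTot_KPerf_holds)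
open Summit.QuantumFields.BalabanUV.Beta.GAN24.KSlotJMHolds (kSlotJM_holds)
open Summit.QuantumFields.BalabanUV.Beta.FP.PerfectObjects (KTot)
open Summit.QuantumFields.BalabanUV.Beta.FP.PerfectObjectsT (KPerf)
open Summit.QuantumFields.BalabanUV.Beta.FP.PerfectTelescopingFiniteComposite (KTot_inl_inr_zsmul)

variable {d : ℕ} (Lc : ℕ) [NeZero Lc]

/-! ## §1 The finite-level column semigroup of the (j, m)-resolvents -/

/-- [folklore] The `Lc^(j+1)`-contour sum of the translated level-`Lc^(j+m+1)` minimiser column IS `(Lc^(j+1))^(d+2)` times the `(inl, inr)`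
block of the `(j+1, m)`-resolvent at an `Lc^m`-coarse second argument (`sum_LegIdx_eq_contourSum` + `KTot_inl_inr_zsmul`). -/
theorem contourSum_Hcol_eq_KTot (j m : ℕ) (μ l'' : Fin (d + 1)) (z' w' : Fin (d + 1) → ℤ) :
    contourSum (Lc ^ (j + 1)) (Hcol (N := Lc ^ (j + 1 + m)) (d := d) μ z') l'' w'
      = ((((Lc ^ (j + 1) : ℕ) : ℝ)) ^ (d + 2))
          * KTot (d := d) (Lc ^ (j + 1 + m)) (Lc ^ (j + 1)) w' (((Lc ^ m : ℕ) : ℤ) • z') (Sum.inl l'') (Sum.inr μ) := by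
  haveI : NeZero (Lc ^ (j + 1)) := ⟨pow_ne_zero _ (NeZero.ne Lc)⟩
  have hP : ((((Lc ^ (j + 1) : ℕ) : ℝ)) ^ (d + 2)) ≠ 0 := pow_ne_zero _ (by exact_mod_cast NeZero.ne (Lc ^ (j + 1)))
  rw [KTot_inl_inr_zsmul, ← mul_assoc, mul_inv_cancel₀ hP, one_mul, ← sum_LegIdx_eq_contourSum]
  rfl

/-- [folklore] **THE COLUMN SEMIGROUP AT FINITE LEVEL.**  For every `Lc ≥ 1`, `j`, `m` and every `d`: the `(inl κ, inr μ)` entry of the `(j, m+1)`-resolvent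
`KTot (Lc^(j+m+1)) (Lc^j)` at an `Lc^(m+1)`-coarse second argument is `(Lc^(j+1))^(d+2)` times the composite, over the intermediate `Lc`-coarse bonds
`(l″, w′)` of the step-`j` lattice, of the ONE-step column `KTot (Lc^(j+1)) (Lc^j) x′ (Lc•w′) (inl κ) (inr l″)` (= `KInvStep Lc j`) with the `(j+1, m)`-column
`KTot (Lc^(j+1+m)) (Lc^(j+1)) w′ (Lc^m•z′) (inl l″) (inr μ)` — an5's TWO-LEVEL REPRODUCTION OF MINIMISERS `ResolventComposition.wH_reproduction`
(`N′ = M·L` with `M = Lc^(j+1)`, `L = Lc^m`) read through the block-contour decimation `dec (Lc^j)`.  «ℋ_{Lc^{m+1}} = ℋ_{Lc} ∘ lift_{Lc}(ℋ_{Lc^m})» at level `j`. -/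
theorem kTot_column_semigroup (j m : ℕ) (κ μ : Fin (d + 1)) (x' z' : Fin (d + 1) → ℤ) :
    KTot (d := d) (Lc ^ (j + 1 + m)) (Lc ^ j) x' (((Lc ^ (m + 1) : ℕ) : ℤ) • z') (Sum.inl κ) (Sum.inr μ)
      = ((((Lc ^ (j + 1) : ℕ) : ℝ)) ^ (d + 2))
          * ∑' w' : Fin (d + 1) → ℤ, ∑ l'' : Fin (d + 1),
              KTot (d := d) (Lc ^ (j + 1)) (Lc ^ j) x' ((Lc : ℤ) • w') (Sum.inl κ) (Sum.inr l'')
                * KTot (d := d) (Lc ^ (j + 1 + m)) (Lc ^ (j + 1)) w' (((Lc ^ m : ℕ) : ℤ) • z') (Sum.inl l'') (Sum.inr μ) := by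
  haveI : NeZero (Lc ^ (j + 1)) := ⟨pow_ne_zero _ (NeZero.ne Lc)⟩
  haveI : NeZero (Lc ^ m) := ⟨pow_ne_zero _ (NeZero.ne Lc)⟩
  have hN : Lc ^ (j + 1 + m) = Lc ^ (j + 1) * Lc ^ m := by rw [← pow_add]
  -- the left-hand side as a leg sum of the level-`Lc^(j+1+m)` minimiser column (`(j, m+1)` = `(j, 1 + m)` after `j + 1 + m = j + (m + 1)`)
  have eL : KTot (d := d) (Lc ^ (j + 1 + m)) (Lc ^ j) x' (((Lc ^ (m + 1) : ℕ) : ℤ) • z') (Sum.inl κ) (Sum.inr μ)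
      = ((((Lc ^ j : ℕ) : ℝ)) ^ (d + 2))⁻¹ * ∑ i ∈ LegIdx d (Lc ^ j),
          wH (N := Lc ^ (j + 1 + m)) (d := d) κ μ (legPt (Lc ^ j) (Sum.inl κ : Fib d) x' i - ((Lc ^ (j + 1 + m) : ℕ) : ℤ) • z') := by
    have h := KTot_inl_inr_zsmul (d := d) Lc j (1 + m) κ μ x' z'
    rw [show j + (1 + m) = j + 1 + m by omega, show 1 + m = m + 1 by omega] at h
    exact h
  rw [eL]
  -- an5's reproduction, leg by leg
  have eR : ∀ i ∈ LegIdx d (Lc ^ j),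
      wH (N := Lc ^ (j + 1 + m)) (d := d) κ μ (legPt (Lc ^ j) (Sum.inl κ : Fib d) x' i - ((Lc ^ (j + 1 + m) : ℕ) : ℤ) • z')
        = ∑' w' : Fin (d + 1) → ℤ, ∑ l'' : Fin (d + 1),
            contourSum (Lc ^ (j + 1)) (Hcol (N := Lc ^ (j + 1 + m)) (d := d) μ z') l'' w'
              * wH (N := Lc ^ (j + 1)) (d := d) κ l'' (legPt (Lc ^ j) (Sum.inl κ : Fib d) x' i - ((Lc ^ (j + 1) : ℕ) : ℤ) • w') :=
    fun i _ => wH_reproduction (d := d) hN μ z' κ _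
  rw [Finset.sum_congr rfl eR]
  -- summability of every leg's series (bounded contour sums × decaying one-step columns)
  obtain ⟨CT, _, hTb, _⟩ := Hcol_bdd_summable (N := Lc ^ (j + 1 + m)) (d := d)
  have hcs : ∀ l'' w', |contourSum (Lc ^ (j + 1)) (Hcol (N := Lc ^ (j + 1 + m)) (d := d) μ z') l'' w'|
      ≤ ((Lc ^ (j + 1)) ^ (d + 1) * Lc ^ (j + 1) : ℕ) * CT := by
    intro l'' w'
    unfold contourSum
    refine (Finset.abs_sum_le_sum_abs _ _).trans ?_
    refine (Finset.sum_le_sum fun b _ => (Finset.abs_sum_le_sum_abs _ _).trans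
      (Finset.sum_le_sum fun s _ => hTb μ z' l'' _)).trans ?_
    simp only [Finset.sum_const, Finset.card_range, nsmul_eq_mul, AffineAveraging.box, Fintype.card_piFinset,
      Finset.prod_const, Finset.card_univ, Fintype.card_fin]
    push_cast
    exact le_of_eq (by ring)
  have hsum : ∀ i ∈ LegIdx d (Lc ^ j), Summable fun w' : Fin (d + 1) → ℤ => ∑ l'' : Fin (d + 1),
      contourSum (Lc ^ (j + 1)) (Hcol (N := Lc ^ (j + 1 + m)) (d := d) μ z') l'' w'
        * wH (N := Lc ^ (j + 1)) (d := d) κ l'' (legPt (Lc ^ j) (Sum.inl κ : Fib d) x' i - ((Lc ^ (j + 1) : ℕ) : ℤ) • w') :=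
    fun i _ => summable_sum fun l'' _ => summable_mul_of_bdd (hcs l'') (summable_wH_sub_zsmul (Lc ^ (j + 1)) κ l'' _)
  rw [← Summable.tsum_finsetSum hsum, ← tsum_mul_left, ← tsum_mul_left]
  refine tsum_congr fun w' => ?_
  -- regroup: `Σ_i c · wH_M(… i …) = c · (P^{d+2} · KTot_{j,1})`, and `c = (Lc^(j+1))^(d+2) · KTot_{j+1,m}`
  have e1 : ∀ l'' : Fin (d + 1), KTot (d := d) (Lc ^ (j + 1)) (Lc ^ j) x' ((Lc : ℤ) • w') (Sum.inl κ) (Sum.inr l'')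
      = ((((Lc ^ j : ℕ) : ℝ)) ^ (d + 2))⁻¹ * ∑ i ∈ LegIdx d (Lc ^ j),
          wH (N := Lc ^ (j + 1)) (d := d) κ l'' (legPt (Lc ^ j) (Sum.inl κ : Fib d) x' i - ((Lc ^ (j + 1) : ℕ) : ℤ) • w') := by
    intro l''
    have h := KTot_inl_inr_zsmul (d := d) Lc j 1 κ l'' x' w'
    rw [pow_one] at h
    exact h
  rw [Finset.sum_comm]
  simp only [contourSum_Hcol_eq_KTot, e1, Finset.mul_sum, Finset.sum_mul]
  refine Finset.sum_congr rfl fun l'' _ => Finset.sum_congr rfl fun i _ => ?_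
  ring

/-! ## §2 The adopted units: the column semigroup is EXACT with unit scalar `1` -/

omit [NeZero Lc] in
/-- [folklore] In the adopted units `sf j = Lc^j`, `sm j = Lc^{j(d+1)}` (`GAN24.CombesThomas.sfStep ∕ smStep`) the `(inl, inr)` unit factor of level `j+1` is
`(Lc^(j+1))^(d+2)` — exactly the scalar of §1. -/
theorem sfStep_mul_smStep_succ (j : ℕ) : sfStep Lc (j + 1) * smStep d Lc (j + 1) = (((Lc ^ (j + 1) : ℕ) : ℝ)) ^ (d + 2) := by
  simp only [sfStep, smStep]
  push_cast
  ring

/-- [folklore] **THE COLUMN SEMIGROUP AT FINITE LEVEL IN THE ADOPTED UNITS — scalar `1`.**  With `U_{j,m} := unitK (sfStep Lc j) (smStep d Lc j) (KTot (Lc^(j+m)) (Lc^j))`: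
`U_{j,m+1} x′ (Lc^(m+1)•z′) (inl κ) (inr μ) = Σ'_{w′} Σ_{l″} U_{j,1} x′ (Lc•w′) (inl κ) (inr l″) · U_{j+1,m} w′ (Lc^m•z′) (inl l″) (inr μ)` for every `j`, `m`, `d`, `Lc ≥ 1`. -/
theorem unitK_kTot_column_semigroup (j m : ℕ) (κ μ : Fin (d + 1)) (x' z' : Fin (d + 1) → ℤ) :
    unitK (sfStep Lc j) (smStep d Lc j) (KTot (d := d) (Lc ^ (j + 1 + m)) (Lc ^ j)) x' (((Lc ^ (m + 1) : ℕ) : ℤ) • z') (Sum.inl κ) (Sum.inr μ)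
      = ∑' w' : Fin (d + 1) → ℤ, ∑ l'' : Fin (d + 1),
          unitK (sfStep Lc j) (smStep d Lc j) (KTot (d := d) (Lc ^ (j + 1)) (Lc ^ j)) x' ((Lc : ℤ) • w') (Sum.inl κ) (Sum.inr l'')
            * unitK (sfStep Lc (j + 1)) (smStep d Lc (j + 1)) (KTot (d := d) (Lc ^ (j + 1 + m)) (Lc ^ (j + 1))) w'
                (((Lc ^ m : ℕ) : ℤ) • z') (Sum.inl l'') (Sum.inr μ) := by
  simp only [HessKerDressedUnits.unitK_apply, HessKerDressedUnits.legScale_inl, HessKerDressedUnits.legScale_inr]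
  rw [kTot_column_semigroup, ← sfStep_mul_smStep_succ (d := d) Lc j]
  simp only [← tsum_mul_left, ← tsum_mul_right, Finset.mul_sum, Finset.sum_mul]
  refine tsum_congr fun w' => Finset.sum_congr rfl fun l'' _ => ?_
  ring

/-! ## §3 The limit: THE PERFECT COLUMNS COMPOSE (`d + 1 = 4`, `Lc ≥ 2`, `m ≥ 1`) -/

/-- [folklore] A kernel decaying at a positive rate is bounded by its constant (as `PerfectTelescopingHolds.decays_le_const`). -/
theorem abs_le_of_decays {K : MKer (d + 1) (Fib d)} {C δ : ℝ} (hK : Decays K C δ) (hδ : 0 ≤ δ) (x y : Fin (d + 1) → ℤ) (a b : Fib d) :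
    |K x y a b| ≤ C :=
  PerfectTelescopingHolds.decays_le_const hK hδ x y a b

/-- [our proof] **THE PERFECT COLUMNS COMPOSE — UNCONDITIONAL at `d + 1 = 4`, `Lc ≥ 2`, every `m ≥ 1`.**  With
`KPerf … m := KPerf Lc (sfStep Lc) (smStep 3 Lc) m` the perfect resolvent of the `m`-fold step in the adopted units, for all coarse bonds `(μ, z′)` of the
`Lc^(m+1)`-lattice and all fine bonds `(κ, x′)`:
`[KPerf … (m+1)] x′ (Lc^(m+1)•z′) (inl κ) (inr μ) = Σ'_{w′} Σ_{l″} [KPerf … 1] x′ (Lc•w′) (inl κ) (inr l″) · [KPerf … m] w′ (Lc^m•z′) (inl l″) (inr μ)`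
— «ℋ_{Lc^{m+1}} = ℋ_{Lc} ∘ lift_{Lc}(ℋ_{Lc^m})»: the `(m+1)`-fold perfect minimiser column is the ONE-step perfect column composed with the `m`-fold perfect column
read on the `Lc`-sublattice.  §2 at every `j`, then `j → ∞` entrywise: the three families converge (`RealRateKMHolds.tendsto_KTot_KPerf_holds`, the `(j+1, m)`
family by the index shift `j ↦ j+1`) and the `w′`-series is dominated uniformly in `j` (`KSlotJMHolds.kSlotJM_holds`: `j`-uniform `Decays` of the one-step
family ⟹ a summable exponential majorant; the `m`-fold family is `j`-uniformly bounded) — Tannery (`tendsto_tsum_of_dominated_convergence`) and uniqueness of limits. -/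
theorem kPerf_column_semigroup (hLc : 2 ≤ Lc) {m : ℕ} (hm : 1 ≤ m) (κ μ : Fin (3 + 1)) (x' z' : Fin (3 + 1) → ℤ) :
    KPerf (d := 3) Lc (sfStep Lc) (smStep 3 Lc) (m + 1) x' (((Lc ^ (m + 1) : ℕ) : ℤ) • z') (Sum.inl κ) (Sum.inr μ)
      = ∑' w' : Fin (3 + 1) → ℤ, ∑ l'' : Fin (3 + 1),
          KPerf (d := 3) Lc (sfStep Lc) (smStep 3 Lc) 1 x' ((Lc : ℤ) • w') (Sum.inl κ) (Sum.inr l'')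
            * KPerf (d := 3) Lc (sfStep Lc) (smStep 3 Lc) m w' (((Lc ^ m : ℕ) : ℤ) • z') (Sum.inl l'') (Sum.inr μ) := by
  have hm1 : 1 ≤ m + 1 := Nat.le_add_left 1 m
  -- (i) the left-hand sides converge to the perfect `(m+1)`-fold column
  have hL : Tendsto (fun j => unitK (sfStep Lc j) (smStep 3 Lc j) (KTot (d := 3) (Lc ^ (j + 1 + m)) (Lc ^ j)) x'
      (((Lc ^ (m + 1) : ℕ) : ℤ) • z') (Sum.inl κ) (Sum.inr μ)) atTop
      (𝓝 (KPerf (d := 3) Lc (sfStep Lc) (smStep 3 Lc) (m + 1) x' (((Lc ^ (m + 1) : ℕ) : ℤ) • z') (Sum.inl κ) (Sum.inr μ))) := by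
    refine (tendsto_KTot_KPerf_holds (Lc := Lc) hLc hm1 x' (((Lc ^ (m + 1) : ℕ) : ℤ) • z') (Sum.inl κ) (Sum.inr μ)).congr fun j => ?_
    rw [show j + (m + 1) = j + 1 + m by omega]
  -- (ii) the one-step factors converge, the shifted `m`-fold factors converge
  have h1 : ∀ (w' : Fin (3 + 1) → ℤ) (l'' : Fin (3 + 1)),
      Tendsto (fun j => unitK (sfStep Lc j) (smStep 3 Lc j) (KTot (d := 3) (Lc ^ (j + 1)) (Lc ^ j)) x' ((Lc : ℤ) • w') (Sum.inl κ) (Sum.inr l''))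
        atTop (𝓝 (KPerf (d := 3) Lc (sfStep Lc) (smStep 3 Lc) 1 x' ((Lc : ℤ) • w') (Sum.inl κ) (Sum.inr l''))) :=
    fun w' l'' => tendsto_KTot_KPerf_holds (Lc := Lc) hLc le_rfl x' ((Lc : ℤ) • w') (Sum.inl κ) (Sum.inr l'')
  have h2 : ∀ (w' : Fin (3 + 1) → ℤ) (l'' : Fin (3 + 1)),
      Tendsto (fun j => unitK (sfStep Lc (j + 1)) (smStep 3 Lc (j + 1)) (KTot (d := 3) (Lc ^ (j + 1 + m)) (Lc ^ (j + 1))) w'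
        (((Lc ^ m : ℕ) : ℤ) • z') (Sum.inl l'') (Sum.inr μ)) atTop
        (𝓝 (KPerf (d := 3) Lc (sfStep Lc) (smStep 3 Lc) m w' (((Lc ^ m : ℕ) : ℤ) • z') (Sum.inl l'') (Sum.inr μ))) :=
    fun w' l'' => (tendsto_KTot_KPerf_holds (Lc := Lc) hLc hm w' (((Lc ^ m : ℕ) : ℤ) • z') (Sum.inl l'') (Sum.inr μ)).comp
      (tendsto_add_atTop_nat 1)
  -- (iii) a `j`-uniform summable majorant of the `w′`-series
  obtain ⟨C₁, δ₁, _, _, hδ₁, _, _, hD₁, _⟩ := kSlotJM_holds (Lc := Lc) hLc (le_refl 1)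
  obtain ⟨Cm, δm, _, _, hδm, _, _, hDm, _⟩ := kSlotJM_holds (Lc := Lc) hLc hm
  have hC₁ : 0 ≤ C₁ := (hD₁ 0).nonneg (Sum.inl 0)
  have hCm : 0 ≤ Cm := (hDm 0).nonneg (Sum.inl 0)
  have hbound : ∀ (j : ℕ) (w' : Fin (3 + 1) → ℤ),
      ‖∑ l'' : Fin (3 + 1),
          unitK (sfStep Lc j) (smStep 3 Lc j) (KTot (d := 3) (Lc ^ (j + 1)) (Lc ^ j)) x' ((Lc : ℤ) • w') (Sum.inl κ) (Sum.inr l'')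
            * unitK (sfStep Lc (j + 1)) (smStep 3 Lc (j + 1)) (KTot (d := 3) (Lc ^ (j + 1 + m)) (Lc ^ (j + 1))) w'
                (((Lc ^ m : ℕ) : ℤ) • z') (Sum.inl l'') (Sum.inr μ)‖
        ≤ ((3 + 1 : ℕ) : ℝ) * (C₁ * Real.exp (-δ₁ * l1 ((Lc : ℤ) • w' - x')) * Cm) := by
    intro j w'
    rw [Real.norm_eq_abs]
    refine (Finset.abs_sum_le_sum_abs _ _).trans ?_
    have hterm : ∀ l'' ∈ (Finset.univ : Finset (Fin (3 + 1))),
        |unitK (sfStep Lc j) (smStep 3 Lc j) (KTot (d := 3) (Lc ^ (j + 1)) (Lc ^ j)) x' ((Lc : ℤ) • w') (Sum.inl κ) (Sum.inr l'')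
            * unitK (sfStep Lc (j + 1)) (smStep 3 Lc (j + 1)) (KTot (d := 3) (Lc ^ (j + 1 + m)) (Lc ^ (j + 1))) w'
                (((Lc ^ m : ℕ) : ℤ) • z') (Sum.inl l'') (Sum.inr μ)|
          ≤ C₁ * Real.exp (-δ₁ * l1 ((Lc : ℤ) • w' - x')) * Cm := by
      intro l'' _
      rw [abs_mul]
      refine mul_le_mul ?_ (abs_le_of_decays (hDm (j + 1)) hδm.le _ _ _ _) (abs_nonneg _) (by positivity)
      have h := hD₁ j x' ((Lc : ℤ) • w') (Sum.inl κ) (Sum.inr l'')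
      rw [show j + 1 = j + 1 from rfl] at h
      rwa [ExpKernelCalculus.l1_sub_symm] at h
    refine (Finset.sum_le_sum hterm).trans ?_
    rw [Finset.sum_const, Finset.card_univ, Fintype.card_fin, nsmul_eq_mul]
  have hsum : Summable fun w' : Fin (3 + 1) → ℤ => ((3 + 1 : ℕ) : ℝ) * (C₁ * Real.exp (-δ₁ * l1 ((Lc : ℤ) • w' - x')) * Cm) := by
    have h := ((PerfectTelescopingLimit.summable_exp_dilate (d := 3) Lc hδ₁ x').mul_left C₁).mul_right Cm
    exact h.mul_left _
  -- (iv) Tannery for the right-hand sides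
  have hR : Tendsto (fun j => ∑' w' : Fin (3 + 1) → ℤ, ∑ l'' : Fin (3 + 1),
      unitK (sfStep Lc j) (smStep 3 Lc j) (KTot (d := 3) (Lc ^ (j + 1)) (Lc ^ j)) x' ((Lc : ℤ) • w') (Sum.inl κ) (Sum.inr l'')
        * unitK (sfStep Lc (j + 1)) (smStep 3 Lc (j + 1)) (KTot (d := 3) (Lc ^ (j + 1 + m)) (Lc ^ (j + 1))) w'
            (((Lc ^ m : ℕ) : ℤ) • z') (Sum.inl l'') (Sum.inr μ)) atTop
      (𝓝 (∑' w' : Fin (3 + 1) → ℤ, ∑ l'' : Fin (3 + 1),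
          KPerf (d := 3) Lc (sfStep Lc) (smStep 3 Lc) 1 x' ((Lc : ℤ) • w') (Sum.inl κ) (Sum.inr l'')
            * KPerf (d := 3) Lc (sfStep Lc) (smStep 3 Lc) m w' (((Lc ^ m : ℕ) : ℤ) • z') (Sum.inl l'') (Sum.inr μ))) := by
    refine tendsto_tsum_of_dominated_convergence hsum (fun w' => ?_) (Eventually.of_forall fun j w' => hbound j w')
    exact tendsto_finsetSum _ fun l'' _ => (h1 w' l'').mul (h2 w' l'')
  -- (v) the two sequences coincide at every `j` (§2); limits are unique
  have hEq : (fun j => unitK (sfStep Lc j) (smStep 3 Lc j) (KTot (d := 3) (Lc ^ (j + 1 + m)) (Lc ^ j)) x'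
      (((Lc ^ (m + 1) : ℕ) : ℤ) • z') (Sum.inl κ) (Sum.inr μ))
      = (fun j => ∑' w' : Fin (3 + 1) → ℤ, ∑ l'' : Fin (3 + 1),
      unitK (sfStep Lc j) (smStep 3 Lc j) (KTot (d := 3) (Lc ^ (j + 1)) (Lc ^ j)) x' ((Lc : ℤ) • w') (Sum.inl κ) (Sum.inr l'')
        * unitK (sfStep Lc (j + 1)) (smStep 3 Lc (j + 1)) (KTot (d := 3) (Lc ^ (j + 1 + m)) (Lc ^ (j + 1))) w'
            (((Lc ^ m : ℕ) : ℤ) • z') (Sum.inl l'') (Sum.inr μ)) :=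
    funext fun j => unitK_kTot_column_semigroup (d := 3) Lc j m κ μ x' z'
  rw [hEq] at hL
  exact tendsto_nhds_unique hL hR

end Summit.QuantumFields.BalabanUV.Beta.FP.PerfectColumnSemigroup

end
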